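import Summits.ResolutionOfSingularities.ResolutionOfSingularities.Theorems.WeightedInvariantIota3JSigmaDominanceUpgrade
import Summits.ResolutionOfSingularities.ResolutionOfSingularities.Theorems.WeightedInvariantIota3SigmaRatioAttained
import Mathlib.Algebra.Order.Floor.Div
import HarnessLib

/-!
# P3c≤3 EXISTENCE, (EX-4) middle, part (L3a)/(L3b): level monotonicity of the max-ratio filtrations and the CAUCHY RE-CHOICE inclusion
# (door `HypersurfaceCentreConstruction`, stmt-ResolutionOfSingularities-19897; (o70-a) step (EX-4); hand res-D-pv-038)

Topic: `Summits/ResolutionOfSingularities/ResolutionOfSingularities/Theorems`. Helper for the door item `HypersurfaceCentreConstruction`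
(stmt-ResolutionOfSingularities-19897, route `WeightedInvariant`), line `local-engine` (L W4.3), def-free.  Two elementary inclusions of the
two-flag filtrations at a fixed ratio `a/b` (triples `(q ; ta, tb)`, level `μ = t/q`) used by the limit construction (L3) of the two-flag
termination of steepening (res-D-pv-038 2026-08-27T20:20:38Z):

* §1 `flagContactFiltration_ratio_antitone_level` — (L3a) LEVEL MONOTONICITY: for one flag and one ratio, the level-`μ'` piece lies in the
  level-`μ` piece for `μ ≤ μ'` (`t q' ≤ t' q`): `Fil(q'; t'a, t'b)(t'aν) ≤ Fil(q; ta, tb)(taν)`; hence a flag reaching a level reaches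
  every lower level (`flagReaches` form).
* §2 `flagContactFiltration_ratio_weight₁_le_big_sup_pow` / `…weight₂_le_span_sup_pow` — (L3b) THE RE-CHOICE INCLUSIONS: at ratio `a/b`,
  `Fil(q; ta, tb)(ta) ≤ I₁ ⊔ 𝔪^⌈t/q⌉` where `I₁ = ⨆_{α ≥ 1 ∨ a ≤ bβ} (g₁^α g₂^β)` is LEVEL-FREE and lies in `Fil(q'; t'a, t'b)(t'a)` for
  EVERY level (`big_le_flagContactFiltration_ratio_weight₁`), and `Fil(q; ta, tb)(tb) ≤ (g₁, g₂) ⊔ 𝔪^⌈tb/q⌉` with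
  `(g₁, g₂) ≤ Fil(q'; t'a, t'b)(t'b)` always.

[OURS · L1 W4.3 · (o70-a) step (EX-4) (L3a)(L3b)]  Replaces the role of NO printed item; NOT a statement of the manuscript
[claim: Hironaka2017, status: under-review]. AI work, weaker than expert review.  Pure commutative algebra; no named facts.

## References

* H. Hironaka, *Characteristic polyhedra of singularities*, J. Math. Kyoto Univ. 7 (1967), §1. [Hironaka1967]
* res-D-pv-038, (L3) DESIGN, HOME/STATUS 2026-08-27T20:20:38Z (OURS, AI planning).
-/

noncomputable section

open IsLocalRing Literature.AlgebraicGeometry.Resolution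
open Summit.ResolutionOfSingularities.ResolutionOfSingularities.Theorems

set_option linter.dupNamespace false -- mandated namespace of this single-conjunct summit

namespace Summit.ResolutionOfSingularities.ResolutionOfSingularities.Cruxes.HypersurfaceCentreConstruction.LocalEngine

namespace Iota3

namespace RatContact

variable {T : Type} [CommRing T] [IsLocalRing T]

/-! ## §1 Level monotonicity at a fixed ratio -/

/-- `⌈t' m / q'⌉ ≥ ⌈t m / q⌉` when `t/q ≤ t'/q'` (`t q' ≤ t' q`). [folklore] -/
theorem ceilDiv_mono_level {t q t' q' : ℕ} (hq : 0 < q) (hq' : 0 < q') (hle : t * q' ≤ t' * q) (m : ℕ) :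
    (t * m) ⌈/⌉ q ≤ (t' * m) ⌈/⌉ q' := by
  rw [ceilDiv_le_iff_le_smul hq, smul_eq_mul]
  -- `t m ≤ q ⌈t' m / q'⌉` from `t m q' ≤ t' m q ≤ q q' ⌈t' m/q'⌉`
  have h1 : t' * m ≤ q' * ((t' * m) ⌈/⌉ q') := le_mul_ceilDiv hq'
  have h2 : q' * (t * m) ≤ q' * (q * ((t' * m) ⌈/⌉ q')) := by
    calc q' * (t * m) = t * q' * m := by ring
      _ ≤ t' * q * m := Nat.mul_le_mul_right m hle
      _ = q * (t' * m) := by ring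
      _ ≤ q * (q' * ((t' * m) ⌈/⌉ q')) := Nat.mul_le_mul_left q h1
      _ = q' * (q * ((t' * m) ⌈/⌉ q')) := by ring
  exact Nat.le_of_mul_le_mul_left h2 hq'

/-- **(L3a) LEVEL MONOTONICITY at a fixed ratio `a/b`**: for `t/q ≤ t'/q'`,
`Fil(g₁, g₂ ; q', t'a, t'b)(t'aν) ≤ Fil(g₁, g₂ ; q, ta, tb)(taν)` — a flag reaching a level reaches every lower level. [OURS · (EX-4) (L3a)] -/
theorem flagContactFiltration_ratio_antitone_level (g₁ g₂ : T) {a b q t q' t' : ℕ} (hq : 0 < q) (hq' : 0 < q')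
    (hle : t * q' ≤ t' * q) (ν : ℕ) :
    flagContactFiltration g₁ g₂ q' (t' * a) (t' * b) (t' * a * ν) ≤ flagContactFiltration g₁ g₂ q (t * a) (t * b) (t * a * ν) := by
  rw [flagContactFiltration_def, flagContactFiltration_def]
  refine iSup_le fun α => iSup_le fun β => le_iSup_of_le α (le_iSup_of_le β (Ideal.mul_mono_right (Ideal.pow_le_pow_right ?_)))
  rw [← Nat.ceilDiv_eq_add_pred_div, ← Nat.ceilDiv_eq_add_pred_div]
  have h1 : t * a * ν - t * a * α - t * b * β = t * (a * ν - a * α - b * β) := by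
    rw [mul_tsub, mul_tsub]; ring_nf
  have h2 : t' * a * ν - t' * a * α - t' * b * β = t' * (a * ν - a * α - b * β) := by
    rw [mul_tsub, mul_tsub]; ring_nf
  rw [h1, h2]
  exact ceilDiv_mono_level hq hq' hle _

/-! ## §2 The re-choice inclusions -/

/-- **(L3b₁) `Fil(q ; ta, tb)(ta) ≤ I₁ ⊔ 𝔪^⌈t/q⌉`** with the LEVEL-FREE ideal `I₁ = ⨆_{α ≥ 1 ∨ a ≤ bβ} (g₁^α g₂^β)` (`0 < b ≤ a`): the pieces
with `α = 0`, `bβ < a` have exponent `⌈t(a − bβ)/q⌉ ≥ ⌈t/q⌉` since `a − bβ ≥ 1`. [OURS · (EX-4) (L3b)] -/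
theorem flagContactFiltration_ratio_weight₁_le_big_sup_pow (g₁ g₂ : T) {a b q t : ℕ} (hq : 0 < q) :
    flagContactFiltration g₁ g₂ q (t * a) (t * b) (t * a) ≤
      (⨆ (α : ℕ) (β : ℕ) (_ : 1 ≤ α ∨ a ≤ b * β), Ideal.span {g₁ ^ α * g₂ ^ β}) ⊔ maximalIdeal T ^ (t ⌈/⌉ q) := by
  rw [flagContactFiltration_def]
  refine iSup_le fun α => iSup_le fun β => ?_
  by_cases hbig : 1 ≤ α ∨ a ≤ b * β
  · exact le_sup_of_le_left (Ideal.mul_le_right.trans (le_iSup_of_le α (le_iSup_of_le β (le_iSup_of_le hbig le_rfl))))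
  · push Not at hbig
    obtain ⟨hα, hβ⟩ := hbig
    have hα0 : α = 0 := by omega
    subst hα0
    refine le_sup_of_le_right (Ideal.mul_le_left.trans (Ideal.pow_le_pow_right ?_))
    rw [← Nat.ceilDiv_eq_add_pred_div, mul_zero, Nat.sub_zero]
    -- `⌈t/q⌉ ≤ ⌈(ta − tbβ)/q⌉` since `t ≤ ta − tbβ = t(a − bβ)`, `a − bβ ≥ 1`
    have hle : t * 1 ≤ t * a - t * b * β := by
      rw [mul_assoc, ← mul_tsub]
      exact Nat.mul_le_mul_left t (by omega)
    rw [mul_one] at hle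
    rw [ceilDiv_le_iff_le_smul hq, smul_eq_mul]
    exact hle.trans (le_mul_ceilDiv hq)

/-- **`I₁ ≤ Fil(q' ; t'a, t'b)(t'a)` at EVERY level**: a monomial `g₁^α g₂^β` with `α ≥ 1` or `bβ ≥ a` has weight `≥ t'a`. [OURS · (EX-4) (L3b)] -/
theorem big_le_flagContactFiltration_ratio_weight₁ (g₁ g₂ : T) {a b q' t' : ℕ} (hq' : 0 < q') :
    (⨆ (α : ℕ) (β : ℕ) (_ : 1 ≤ α ∨ a ≤ b * β), Ideal.span {g₁ ^ α * g₂ ^ β}) ≤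
      flagContactFiltration g₁ g₂ q' (t' * a) (t' * b) (t' * a) := by
  refine iSup_le fun α => iSup_le fun β => iSup_le fun h => ?_
  rw [flagContactFiltration_def]
  refine le_iSup_of_le α (le_iSup_of_le β ?_)
  have h0 : (t' * a - t' * a * α - t' * b * β + q' - 1) / q' = 0 := by
    have : t' * a - t' * a * α - t' * b * β = 0 := by
      rcases h with hα | hβ
      · have : t' * a ≤ t' * a * α := Nat.le_mul_of_pos_right _ hα
        omega
      · have : t' * a ≤ t' * b * β := by rw [mul_assoc]; exact Nat.mul_le_mul_left t' hβ
        omega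
    rw [this, Nat.zero_add, Nat.div_eq_of_lt (Nat.sub_lt hq' Nat.one_pos)]
  rw [h0, pow_zero, Ideal.one_eq_top, Ideal.mul_top]

/-- **(L3b₂) `Fil(q ; ta, tb)(tb) ≤ (g₁, g₂) ⊔ 𝔪^⌈tb/q⌉`.** [OURS · (EX-4) (L3b)] -/
theorem flagContactFiltration_ratio_weight₂_le_span_sup_pow (g₁ g₂ : T) (q r₁ r₂ : ℕ) :
    flagContactFiltration g₁ g₂ q r₁ r₂ r₂ ≤ Ideal.span {g₁, g₂} ⊔ maximalIdeal T ^ (r₂ ⌈/⌉ q) := by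
  rw [flagContactFiltration_def]
  refine iSup_le fun α => iSup_le fun β => ?_
  by_cases h : α = 0 ∧ β = 0
  · obtain ⟨rfl, rfl⟩ := h
    refine le_sup_of_le_right (Ideal.mul_le_left.trans (le_of_eq ?_))
    rw [← Nat.ceilDiv_eq_add_pred_div, mul_zero, mul_zero, Nat.sub_zero, Nat.sub_zero]
  · refine le_sup_of_le_left (Ideal.mul_le_right.trans ?_)
    rw [Ideal.span_singleton_le_iff_mem]
    rcases not_and_or.mp h with hα | hβ
    · obtain ⟨α', rfl⟩ := Nat.exists_eq_succ_of_ne_zero hα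
      have hg₁ : g₁ ∈ Ideal.span ({g₁, g₂} : Set T) := Ideal.subset_span (by simp)
      have : g₁ ^ (α' + 1) * g₂ ^ β = (g₁ ^ α' * g₂ ^ β) * g₁ := by ring
      rw [this]
      exact Ideal.mul_mem_left _ _ hg₁
    · obtain ⟨β', rfl⟩ := Nat.exists_eq_succ_of_ne_zero hβ
      have hg₂ : g₂ ∈ Ideal.span ({g₁, g₂} : Set T) := Ideal.subset_span (by simp)
      have : g₁ ^ α * g₂ ^ (β' + 1) = (g₁ ^ α * g₂ ^ β') * g₂ := by ring
      rw [this]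
      exact Ideal.mul_mem_left _ _ hg₂

/-- **`(g₁, g₂) ≤ Fil(q' ; r₁', r₂')(r₂')`** for an admissible triple (both members have weight `≥ r₂'`). [folklore] -/
theorem span_pair_le_flagContactFiltration_weight₂ (g₁ g₂ : T) {q' r₁' r₂' : ℕ} (hadm : AdmissibleTriple q' r₁' r₂') :
    Ideal.span {g₁, g₂} ≤ flagContactFiltration g₁ g₂ q' r₁' r₂' r₂' := by
  have hself := self_mem_flagContactFiltration g₁ g₂ r₁' r₂' hadm.1
  rw [Ideal.span_le]
  rintro x hx
  rcases hx with rfl | rfl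
  · exact flagContactFiltration_antitone _ _ q' r₁' r₂' hadm.2.2 hself.1
  · exact hself.2

end RatContact

end Iota3

end Summit.ResolutionOfSingularities.ResolutionOfSingularities.Cruxes.HypersurfaceCentreConstruction.LocalEngine

end
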